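import Literature.AlgebraicGeometry.HodgeTheory.MonodromyGroupBaseChange
import Literature.AlgebraicGeometry.HodgeTheory.TensorStabilizerZariskiClosed
import Literature.AlgebraicGeometry.HodgeTheory.ComplexConjugationHolds
import Literature.AlgebraicGeometry.HodgeTheory.HodgeFiltrationModelsReductionProofs
import HarnessLib

/-!
# Heredity of «a finite-index subgroup of the monodromy group lies in the Mumford–Tate group» along a base
# change, from ONE point to every Hodge-generic point of the base change (CMSP (15.7); CDK-free)

Family `hodge`, layer `Literature/AlgebraicGeometry/HodgeTheory`. THEOREMS only (no definition, no named fact).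
Written by the prover seat `hodge-nonav-prover-Ax` (g16, cell `hodge-nonav`) for route `CyclicUnitaryPowers`
(crux K1 `VeryGeneralDeckCommutatorsInHg`, stmt-HodgeConjecture-19544), programme «HEREDITY»; generic in the
family, the degree and the base change so that route `SignSymmetricPowers` (weight 3) and later routes consume it
by name.

SETTING. A family `π : 𝒳 ⟶ S` of complex varieties, cohomologically locally trivial over `S(ℂ)` (`hU`), its
rational local system `Rᵏ π_* ℚ` with monodromy groups `Γ_s = ratMonodromyGroup π k hU s ≤ GL(Hᵏ(X_s(ℂ); ℚ))`
and rational transports `T` along paths (`IsRatTransport`); for a smooth projective family (`hf`) the Hodge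
structures `Hᵏ(X_s)` read in Hodge-symmetric models `A s` and their tensor-stabiliser Mumford–Tate groups
`MT(Hᵏ(X_s))(ℚ)` (`HodgeStructure.mumfordTateGroup`). Write **FI(s)** for: «some subgroup of finite index of
`Γ_s` is contained in `MT(Hᵏ(X_s))(ℚ)`» — the conclusion (i) of Deligne's lemma (CMSP Lemma–Def. 15.3.7 •,
tree theorem `deligne_finiteIndex_monodromy_le_mumfordTateGroup_of_isQuasiProjectiveOver`) at a Hodge-generic
point, and the per-point input of the route-A kernel
`CyclicUnitaryPowersFiniteIndexMonodromyDeckCommutators.hodgeConjectureFor_powers_of_finiteIndex_le_mumfordTate`.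
By `glIdentityComponent_subset_of_finiteIndex` + `glZariskiClosure_subset_mumfordTateGroup`, FI(s) implies the
identity-component currency «`(Γ_s^Zar)° ⊆ MT(Hᵏ(X_s))`» consumed by route B
(`identityComponent_le_mumfordTate_offCountable_of_pencil`, `signModel_of_identityComponent_le_mumfordTate`).

RESULTS.
* §1 `conj_mem_ratMonodromyGroup_of_isRatTransport`: monodromy groups at path-joined points are conjugate by
  the transport, `T⁻¹ Γ_s T ⊆ Γ_t` for `T` the transport along `δ : s ⇝ t` (Voisin II §3.1.2).
* §2 `exists_finiteIndex_le_mumfordTateGroup_of_isHodgeGenericPoint` (**heredity in one family**): if `s` is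
  Hodge generic (`IsHodgeGenericPoint`), `t` is joined to `s` by a path carrying a rational transport, and FI(t),
  then FI(s). Proof: CMSP (15.7) «`MT(h_t) ⊂ MT(h_{s_gen})`», in the tree as
  `IsHodgeGenericPoint.conj_mem_mumfordTateGroup` (`T⁻¹ MT(Hᵏ(X_t)) T ⊆ MT(Hᵏ(X_s))`), and §1; conjugation
  by `T` preserves finite index.
* §3 `exists_finiteIndex_le_mumfordTateGroup_map_of_isHodgeGenericPoint_familyPullback` (**heredity along a
  base change** `g : S' ⟶ S`, the form the curve theorems use): if FI holds for `π` at `g c₀` and `c` is a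
  Hodge-generic point OF THE BASE CHANGE `π' = 𝒳 ×_S S' → S'` joined to `c₀` in `S'(ℂ)`, then FI holds for `π`
  at `g c` — with the large group `Γ_π(g c)`, not the (possibly much smaller) `Γ_{π'}(c)`. Ingredients:
  transports of `π'` are transports of `π` along image paths conjugated by the fibre identifications
  `e_x : 𝒳'_x ≅ 𝒳_{g x}` (`isRatTransport_familyPullback_iff`); the Hodge structure of `𝒳'_x` is the transport
  of that of `𝒳_{g x}` along `e_x^*` (`hodgeStructure_familyPullback_eq_comapEquiv`, from
  `hodge_eq_comapEquiv_of_iso` and the model-independence `HodgeModel.hodgeStructure_eq_hodge`);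
  `mem_mumfordTateGroup_comapEquiv_iff`. Identity-component corollary
  `glIdentityComponent_ratMonodromyGroup_subset_mumfordTateGroup_of_isHodgeGenericPoint_familyPullback`.

WHY (the point of the programme): over a CURVE `S'` the non-Hodge-generic points of `π'` are COUNTABLE without
Cattani–Deligne–Kaplan (`exists_countable_isHodgeGenericPoint_of_weightTwoFrames_curve`,
`exists_countable_isHodgeGenericPoint_of_griffiths1968_curve`), so FI at ONE member of an algebraic
one-parameter sub-family propagates to all but countably many members — with NO hypothesis on the monodromy
of the sub-family (the Lefschetz∕Zariski input (HL) of `CyclicUnitaryPowersCurvesOfLargeMonodromyHodgeOffCountable`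
is replaced by FI at a point). HONEST FRAMING: structural; nothing here bears on the Cattani–Deligne–Kaplan
floor of items 19544 ∕ 19716; no statement about the Hodge conjecture.

## References
* [CarlsonMullerStachPeters2017] J. Carlson, S. Müller-Stach, C. Peters, *Period Mappings and Period Domains*,
  2nd ed. (2017), §15.3: (15.7) `MT(h_s) ⊂ MT(h_{s_gen})` and Lemma–Definition 15.3.7.
* [VoisinHodgeII2003] C. Voisin, *Hodge Theory and Complex Algebraic Geometry II*, CUP 2003, §3.1.2 (local
  systems, monodromy, base change).
* [Deligne1972WeilK3] P. Deligne, La conjecture de Weil pour les surfaces K3, Invent. Math. 15 (1972), Prop. 7.5.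
-/

noncomputable section

namespace Literature.AlgebraicGeometry.HodgeTheory

open CategoryTheory
open _root_.Topology
open Literature.AlgebraicGeometry.Motives
open Literature.AlgebraicTopology.SingularHomology

universe u

/-! ### §0 Conjugation of subgroups of `GL` by a linear equivalence (bookkeeping) -/

section Conj

variable {K : Type*} [Field K] {V W : Type u} [AddCommGroup V] [Module K V] [AddCommGroup W] [Module K W]

/-- Conjugating a finite-index pair of subgroups of `GL(V)` by a linear equivalence `T : V ≃ W` gives a
finite-index pair in `GL(W)`: if `Γ₀ ≤ Γ` has finite index, `Δ ≤ GL(W)` and `T⁻¹ Δ T ⊆ Γ`, then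
`{T γ T⁻¹ : γ ∈ Γ₀} ⊓ Δ`… precisely the image `Γ₀.map (γ ↦ T⁻¹ ≫ γ ≫ T)` has finite index relative to `Δ`.
[folklore] -/
private theorem relIndex_map_conj_ne_zero (T : V ≃ₗ[K] W) {Γ₀ Γ : Subgroup (V ≃ₗ[K] V)}
    (hfi : (Γ₀.subgroupOf Γ).FiniteIndex) {Δ : Subgroup (W ≃ₗ[K] W)}
    (hΔ : ∀ x ∈ Δ, T.trans (x.trans T.symm) ∈ Γ) :
    ∃ Γ₁ : Subgroup (W ≃ₗ[K] W), (∀ y, y ∈ Γ₁ ↔ T.trans (y.trans T.symm) ∈ Γ₀) ∧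
      (Γ₁.subgroupOf Δ).FiniteIndex := by
  -- conjugation `y ↦ T ≫ y ≫ T⁻¹ : GL(W) →* GL(V)` (as maps, `v ↦ T⁻¹ (y (T v))`)
  let φ : (W ≃ₗ[K] W) →* (V ≃ₗ[K] V) :=
    { toFun := fun y => T.trans (y.trans T.symm)
      map_one' := by ext v; simp [LinearEquiv.one_eq_refl]
      map_mul' := fun y₁ y₂ => by ext v; simp [LinearEquiv.mul_eq_trans] }
  refine ⟨Γ₀.comap φ, fun y => Iff.rfl, ?_⟩
  have h1 : Δ.map φ ≤ Γ := by
    rintro _ ⟨x, hx, rfl⟩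
    exact hΔ x hx
  have h2 : Γ₀.relIndex (Δ.map φ) ≠ 0 := fun h0 =>
    hfi.index_ne_zero (Subgroup.relIndex_eq_zero_of_le_right h1 h0)
  refine ⟨?_⟩
  change (Γ₀.comap φ).relIndex Δ ≠ 0
  rwa [Subgroup.relIndex_comap]

end Conj

/-! ### §1 Monodromy groups at path-joined points are conjugate -/

section Family

variable {𝒳 S : SchemeOver ℂ} (f : 𝒳 ⟶ S) (k : ℕ) {U : Set (ComplexPoints S)}
  (hU : IsCohomologicallyLocallyTrivialOn f U)

/-- **Monodromy groups at path-joined points are conjugate** (Voisin II §3.1.2): if `T` is the rational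
transport along `δ : s ⇝ t` and `g ∈ Γ_s`, then `T⁻¹ ≫ g ≫ T` — the map `w ↦ T (g (T⁻¹ w))` — lies in `Γ_t`
(it is the transport of the loop `δ⁻¹ · γ · δ`). [cite: VoisinHodgeII2003, §3.1.2] -/
theorem conj_mem_ratMonodromyGroup_of_isRatTransport {s t : U} {δ : Path.Homotopic.Quotient s t}
    {T : singularCohomology ℚ ℚ (ComplexPoints (fiberOver f s.1)) k ≃ₗ[ℚ]
      singularCohomology ℚ ℚ (ComplexPoints (fiberOver f t.1)) k}
    (hT : IsRatTransport f k hU δ T)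
    {g : singularCohomology ℚ ℚ (ComplexPoints (fiberOver f s.1)) k ≃ₗ[ℚ]
      singularCohomology ℚ ℚ (ComplexPoints (fiberOver f s.1)) k}
    (hg : g ∈ ratMonodromyGroup f k hU s) :
    T.symm.trans (g.trans T) ∈ ratMonodromyGroup f k hU t := by
  obtain ⟨γ, hγ⟩ := hg
  exact ⟨δ.symm.trans (γ.trans δ), (hT.symm f k hU).trans f k hU (hγ.trans f k hU hT)⟩

/-- The same with the roles of `s`, `t` exchanged: for `T` the transport along `δ : s ⇝ t` and `g ∈ Γ_t`,
`T ≫ g ≫ T⁻¹ ∈ Γ_s`. [cite: VoisinHodgeII2003, §3.1.2] -/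
theorem conj_symm_mem_ratMonodromyGroup_of_isRatTransport {s t : U} {δ : Path.Homotopic.Quotient s t}
    {T : singularCohomology ℚ ℚ (ComplexPoints (fiberOver f s.1)) k ≃ₗ[ℚ]
      singularCohomology ℚ ℚ (ComplexPoints (fiberOver f t.1)) k}
    (hT : IsRatTransport f k hU δ T)
    {g : singularCohomology ℚ ℚ (ComplexPoints (fiberOver f t.1)) k ≃ₗ[ℚ]
      singularCohomology ℚ ℚ (ComplexPoints (fiberOver f t.1)) k}
    (hg : g ∈ ratMonodromyGroup f k hU t) :
    T.trans (g.trans T.symm) ∈ ratMonodromyGroup f k hU s := by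
  have h := conj_mem_ratMonodromyGroup_of_isRatTransport f k hU (hT.symm f k hU) hg
  rwa [LinearEquiv.symm_symm] at h

/-! ### §2 Heredity of FI within one family (CMSP (15.7)) -/

variable {n : ℕ} (hf : IsSmoothProjectiveFamily f n) [HodgeTensorFacts.{0, 0}]
  (A : ∀ t : ComplexPoints S, HodgeModel n (fiberOver f t)) (hA : ∀ t, (A t).IsHodgeSymmetric)
  [∀ t : ComplexPoints S, Module.Finite ℚ (singularCohomology ℚ ℚ (ComplexPoints (fiberOver f t)) k)]

/-- **Heredity of FI towards a Hodge-generic point, within one family** (CMSP (15.7) + Lemma–Def. 15.3.7):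
let `s` be a Hodge-generic point, `δ : s ⇝ t` a path class with rational transport `T`, and suppose a
finite-index subgroup of `Γ_t` lies in `MT(Hᵏ(X_t))(ℚ)`. Then a finite-index subgroup of `Γ_s` lies in
`MT(Hᵏ(X_s))(ℚ)` — namely `T (Γ₀) T⁻¹`, a subgroup of `Γ_s` of the same index (§1), inside `MT(Hᵏ(X_s))` because
the Mumford–Tate group only shrinks away from a Hodge-generic point
(`IsHodgeGenericPoint.conj_mem_mumfordTateGroup`). [cite: CarlsonMullerStachPeters2017, §15.3 (15.7) and Lemma–Definition 15.3.7] -/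
theorem exists_finiteIndex_le_mumfordTateGroup_of_isHodgeGenericPoint {s t : U}
    (hs : IsHodgeGenericPoint f k hU hf A hA s) {δ : Path.Homotopic.Quotient s t}
    {T : singularCohomology ℚ ℚ (ComplexPoints (fiberOver f s.1)) k ≃ₗ[ℚ]
      singularCohomology ℚ ℚ (ComplexPoints (fiberOver f t.1)) k}
    (hT : IsRatTransport f k hU δ T)
    (hFI : ∃ Γ₀ : Subgroup (singularCohomology ℚ ℚ (ComplexPoints (fiberOver f t.1)) k ≃ₗ[ℚ]
        singularCohomology ℚ ℚ (ComplexPoints (fiberOver f t.1)) k),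
      Γ₀ ≤ ratMonodromyGroup f k hU t ∧ (Γ₀.subgroupOf (ratMonodromyGroup f k hU t)).FiniteIndex ∧
        Γ₀ ≤ ((A t.1).hodgeStructure (hf.isSmoothProjective t.1) (hA t.1) k).mumfordTateGroup) :
    ∃ Γ₁ : Subgroup (singularCohomology ℚ ℚ (ComplexPoints (fiberOver f s.1)) k ≃ₗ[ℚ]
        singularCohomology ℚ ℚ (ComplexPoints (fiberOver f s.1)) k),
      Γ₁ ≤ ratMonodromyGroup f k hU s ∧ (Γ₁.subgroupOf (ratMonodromyGroup f k hU s)).FiniteIndex ∧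
        Γ₁ ≤ ((A s.1).hodgeStructure (hf.isSmoothProjective s.1) (hA s.1) k).mumfordTateGroup := by
  obtain ⟨Γ₀, hΓ₀le, hΓ₀fi, hΓ₀MT⟩ := hFI
  -- `Γ₁ = T Γ₀ T⁻¹`, of finite index in `Γ_s` since `T⁻¹ Γ_s T ⊆ Γ_t`
  obtain ⟨Γ₁, hΓ₁, hΓ₁fi⟩ := relIndex_map_conj_ne_zero T.symm hΓ₀fi
    (Δ := ratMonodromyGroup f k hU s) (fun x hx => by
      have h := conj_mem_ratMonodromyGroup_of_isRatTransport f k hU hT hx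
      rwa [LinearEquiv.symm_symm])
  refine ⟨Γ₁, fun y hy => ?_, hΓ₁fi, fun y hy => ?_⟩
  · -- `y = T (T⁻¹ y T) T⁻¹` with `T⁻¹ y T ∈ Γ₀ ≤ Γ_t`
    have hy' := (hΓ₁ y).1 hy
    rw [LinearEquiv.symm_symm] at hy'
    have h := conj_symm_mem_ratMonodromyGroup_of_isRatTransport f k hU hT (hΓ₀le hy')
    have hid : T.trans ((T.symm.trans (y.trans T)).trans T.symm) = y := by
      ext v; simp only [LinearEquiv.trans_apply, LinearEquiv.symm_apply_apply]
    rwa [hid] at h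
  · have hy' := (hΓ₁ y).1 hy
    rw [LinearEquiv.symm_symm] at hy'
    have h := hs.conj_mem_mumfordTateGroup f k hU hf A hA hT (hΓ₀MT hy')
    have hid : T.trans ((T.symm.trans (y.trans T)).trans T.symm) = y := by
      ext v; simp only [LinearEquiv.trans_apply, LinearEquiv.symm_apply_apply]
    rwa [hid] at h

end Family

/-! ### §3 Heredity along a base change -/

section BaseChange

variable {𝒳 S S' : SchemeOver ℂ} (π : 𝒳 ⟶ S) (g : S' ⟶ S) (k : ℕ)
  (hU : IsCohomologicallyLocallyTrivialOn π Set.univ)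
  (hU' : IsCohomologicallyLocallyTrivialOn (familyPullback.snd π g) Set.univ)
  {n : ℕ} (hf : IsSmoothProjectiveFamily π n) [HodgeTensorFacts.{0, 0}]
  (A : ∀ t : ComplexPoints S, HodgeModel n (fiberOver π t)) (hA : ∀ t, (A t).IsHodgeSymmetric)
  (A' : ∀ c : ComplexPoints S', HodgeModel n (fiberOver (familyPullback.snd π g) c))
  (hA' : ∀ c, (A' c).IsHodgeSymmetric)

omit [HodgeTensorFacts.{0, 0}] in
/-- **The Hodge structure of a fibre of the base change is the transport of that of the corresponding fibre**
along the identification `e_c : 𝒳'_c ≅ 𝒳_{g c}`: `H(𝒳'_c) = (e_c⁻¹)^{*,*} H(𝒳_{g c})`, read in ANY Hodge-symmetric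
models (model-independence `HodgeModel.hodgeStructure_eq_hodge` + `hodge_eq_comapEquiv_of_iso`).
[cite: VoisinHodgeII2003, §3.1.2] -/
theorem hodgeStructure_familyPullback_eq_comapEquiv (c : ComplexPoints S') :
    (A' c).hodgeStructure ((hf.familyPullback_snd g).isSmoothProjective c) (hA' c) k =
      ((A (AlgPoints.map g c)).hodgeStructure (hf.isSmoothProjective (AlgPoints.map g c))
        (hA (AlgPoints.map g c)) k).comapEquiv
        (BettiUniverse.pullEquiv (fiberOverFamilyPullbackIso π g c) k) := by
  rw [HodgeModel.hodgeStructure_eq_hodge exists_isReal_hodgeModel_holds hodgePQ_independent_of_hodgeModel_holds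
      ((hf.familyPullback_snd g).isSmoothProjective c) (A' c) (hA' c) k,
    HodgeModel.hodgeStructure_eq_hodge exists_isReal_hodgeModel_holds hodgePQ_independent_of_hodgeModel_holds
      (hf.isSmoothProjective (AlgPoints.map g c)) (A (AlgPoints.map g c)) (hA (AlgPoints.map g c)) k]
  exact BettiUniverse.hodge_eq_comapEquiv_of_iso exists_isReal_hodgeModel_holds hodgePQ_independent_of_hodgeModel_holds
    ((hf.familyPullback_snd g).isSmoothProjective c) (hf.isSmoothProjective (AlgPoints.map g c))
    (fiberOverFamilyPullbackIso π g c) k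

variable [∀ t : ComplexPoints S, Module.Finite ℚ (singularCohomology ℚ ℚ (ComplexPoints (fiberOver π t)) k)]
  [∀ c : ComplexPoints S',
    Module.Finite ℚ (singularCohomology ℚ ℚ (ComplexPoints (fiberOver (familyPullback.snd π g) c)) k)]

/-- **Mumford–Tate groups of the fibres `𝒳'_c` and `𝒳_{g c}` correspond under `e_c`-conjugation**:
`x ∈ MT(Hᵏ(𝒳_{g c})) ↔ E ≫ x ≫ E⁻¹ ∈ MT(Hᵏ(𝒳'_c))`, `E = pullEquiv e_c : Hᵏ(𝒳'_c) ≃ Hᵏ(𝒳_{g c})`.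
[cite: VoisinHodgeII2003, §3.1.2] -/
theorem mem_mumfordTateGroup_familyPullback_iff (c : ComplexPoints S')
    (x : singularCohomology ℚ ℚ (ComplexPoints (fiberOver π (AlgPoints.map g c))) k ≃ₗ[ℚ]
      singularCohomology ℚ ℚ (ComplexPoints (fiberOver π (AlgPoints.map g c))) k) :
    (BettiUniverse.pullEquiv (fiberOverFamilyPullbackIso π g c) k).trans
        (x.trans (BettiUniverse.pullEquiv (fiberOverFamilyPullbackIso π g c) k).symm) ∈
      ((A' c).hodgeStructure ((hf.familyPullback_snd g).isSmoothProjective c) (hA' c) k).mumfordTateGroup ↔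
    x ∈ ((A (AlgPoints.map g c)).hodgeStructure (hf.isSmoothProjective (AlgPoints.map g c))
        (hA (AlgPoints.map g c)) k).mumfordTateGroup := by
  rw [hodgeStructure_familyPullback_eq_comapEquiv π g k hf A hA A' hA' c,
    HodgeStructure.mem_mumfordTateGroup_comapEquiv_iff]
  have hid : (BettiUniverse.pullEquiv (fiberOverFamilyPullbackIso π g c) k).symm.trans
      (((BettiUniverse.pullEquiv (fiberOverFamilyPullbackIso π g c) k).trans
        (x.trans (BettiUniverse.pullEquiv (fiberOverFamilyPullbackIso π g c) k).symm)).trans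
        (BettiUniverse.pullEquiv (fiberOverFamilyPullbackIso π g c) k)) = x := by
    ext v; simp only [LinearEquiv.trans_apply, LinearEquiv.apply_symm_apply]
  rw [hid]

/-- **Heredity of FI along a base change** (CMSP (15.7) for the base change + Voisin II §3.1.2). Let
`g : S' ⟶ S`, `π' = 𝒳 ×_S S' → S'` the base change of the smooth projective family `π`, both cohomologically
locally trivial over all complex points; let `c₀, c ∈ S'(ℂ)` be joined by a path class `δ'` carrying a rational
transport `T'` of `π'`, with `c` HODGE GENERIC FOR `π'`. If some finite-index subgroup of the monodromy group
`Γ_π(g c₀)` of `π` lies in `MT(Hᵏ(𝒳_{g c₀}))(ℚ)`, then some finite-index subgroup of `Γ_π(g c)` lies in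
`MT(Hᵏ(𝒳_{g c}))(ℚ)`. (The transport `T = e_c^* ≫ T' ≫ (e_{c₀}^*)⁻¹` of `π` along `g ∘ δ'` conjugates `Γ_π(g c₀)` onto
`Γ_π(g c)`; genericity of `c` for `π'` gives `T'⁻¹ MT(H(𝒳'_{c₀})) T' ⊆ MT(H(𝒳'_c))`; and `MT(H(𝒳'_x))` is
`MT(H(𝒳_{g x}))` conjugated by `e_x^*`.) [cite: CarlsonMullerStachPeters2017, §15.3 (15.7) and Lemma–Definition 15.3.7]
[cite: VoisinHodgeII2003, §3.1.2] -/
theorem exists_finiteIndex_le_mumfordTateGroup_map_of_isHodgeGenericPoint_familyPullback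
    {c c₀ : ComplexPoints S'}
    (hc : IsHodgeGenericPoint (familyPullback.snd π g) k hU' (hf.familyPullback_snd g) A' hA' ⟨c, Set.mem_univ _⟩)
    {δ' : Path.Homotopic.Quotient (⟨c, Set.mem_univ _⟩ : (Set.univ : Set (ComplexPoints S'))) ⟨c₀, Set.mem_univ _⟩}
    {T' : singularCohomology ℚ ℚ (ComplexPoints (fiberOver (familyPullback.snd π g) c)) k ≃ₗ[ℚ]
      singularCohomology ℚ ℚ (ComplexPoints (fiberOver (familyPullback.snd π g) c₀)) k}
    (hT' : IsRatTransport (familyPullback.snd π g) k hU' δ' T')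
    (hFI : ∃ Γ₀ : Subgroup (singularCohomology ℚ ℚ (ComplexPoints (fiberOver π (AlgPoints.map g c₀))) k ≃ₗ[ℚ]
        singularCohomology ℚ ℚ (ComplexPoints (fiberOver π (AlgPoints.map g c₀))) k),
      Γ₀ ≤ ratMonodromyGroup π k hU ⟨AlgPoints.map g c₀, Set.mem_univ _⟩ ∧
      (Γ₀.subgroupOf (ratMonodromyGroup π k hU ⟨AlgPoints.map g c₀, Set.mem_univ _⟩)).FiniteIndex ∧
        Γ₀ ≤ ((A (AlgPoints.map g c₀)).hodgeStructure (hf.isSmoothProjective (AlgPoints.map g c₀))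
          (hA (AlgPoints.map g c₀)) k).mumfordTateGroup) :
    ∃ Γ₁ : Subgroup (singularCohomology ℚ ℚ (ComplexPoints (fiberOver π (AlgPoints.map g c))) k ≃ₗ[ℚ]
        singularCohomology ℚ ℚ (ComplexPoints (fiberOver π (AlgPoints.map g c))) k),
      Γ₁ ≤ ratMonodromyGroup π k hU ⟨AlgPoints.map g c, Set.mem_univ _⟩ ∧
      (Γ₁.subgroupOf (ratMonodromyGroup π k hU ⟨AlgPoints.map g c, Set.mem_univ _⟩)).FiniteIndex ∧
        Γ₁ ≤ ((A (AlgPoints.map g c)).hodgeStructure (hf.isSmoothProjective (AlgPoints.map g c))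
          (hA (AlgPoints.map g c)) k).mumfordTateGroup := by
  obtain ⟨Γ₀, hΓ₀le, hΓ₀fi, hΓ₀MT⟩ := hFI
  -- the fibre identifications and the transport of `π` along the image path
  let E : singularCohomology ℚ ℚ (ComplexPoints (fiberOver (familyPullback.snd π g) c)) k ≃ₗ[ℚ]
      singularCohomology ℚ ℚ (ComplexPoints (fiberOver π (AlgPoints.map g c))) k :=
    BettiUniverse.pullEquiv (fiberOverFamilyPullbackIso π g c) k
  let E₀ : singularCohomology ℚ ℚ (ComplexPoints (fiberOver (familyPullback.snd π g) c₀)) k ≃ₗ[ℚ]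
      singularCohomology ℚ ℚ (ComplexPoints (fiberOver π (AlgPoints.map g c₀))) k :=
    BettiUniverse.pullEquiv (fiberOverFamilyPullbackIso π g c₀) k
  have hE : E = BettiUniverse.pullEquiv (fiberOverFamilyPullbackIso π g c) k := rfl
  have hE₀ : E₀ = BettiUniverse.pullEquiv (fiberOverFamilyPullbackIso π g c₀) k := rfl
  let T : singularCohomology ℚ ℚ (ComplexPoints (fiberOver π (AlgPoints.map g c))) k ≃ₗ[ℚ]
      singularCohomology ℚ ℚ (ComplexPoints (fiberOver π (AlgPoints.map g c₀))) k :=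
    E.symm ≪≫ₗ T' ≪≫ₗ E₀
  have hTdef : T = E.symm ≪≫ₗ T' ≪≫ₗ E₀ := rfl
  -- `T` is the transport of `π` along the image of (a representative of) `δ'`
  have hT : ∃ δ : Path.Homotopic.Quotient (⟨AlgPoints.map g c, Set.mem_univ _⟩ : (Set.univ : Set (ComplexPoints S)))
      ⟨AlgPoints.map g c₀, Set.mem_univ _⟩, IsRatTransport π k hU δ T := by
    induction δ' using Quotient.ind with | _ γ' => ?_
    refine ⟨⟦γ'.map (baseMapUniv g).continuous⟧, ?_⟩
    rw [hTdef, hE, hE₀, ← isRatTransport_familyPullback_iff π g k hU hU' γ' (γ'.map (baseMapUniv g).continuous)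
      (fun u => rfl) T']
    exact hT'
  obtain ⟨δ, hT⟩ := hT
  -- `Γ₁ = T⁻¹ Γ₀ T`, of finite index in `Γ_π(g c)`
  obtain ⟨Γ₁, hΓ₁, hΓ₁fi⟩ := relIndex_map_conj_ne_zero T.symm hΓ₀fi
    (Δ := ratMonodromyGroup π k hU ⟨AlgPoints.map g c, Set.mem_univ _⟩) (fun x hx => by
      have h := conj_mem_ratMonodromyGroup_of_isRatTransport π k hU hT hx
      rwa [LinearEquiv.symm_symm])
  refine ⟨Γ₁, fun y hy => ?_, hΓ₁fi, fun y hy => ?_⟩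
  · have hy' := (hΓ₁ y).1 hy
    rw [LinearEquiv.symm_symm] at hy'
    have h := conj_symm_mem_ratMonodromyGroup_of_isRatTransport π k hU hT (hΓ₀le hy')
    have hid : T.trans ((T.symm.trans (y.trans T)).trans T.symm) = y := by
      ext v; simp only [LinearEquiv.trans_apply, LinearEquiv.symm_apply_apply]
    rwa [hid] at h
  · have hy' := (hΓ₁ y).1 hy
    rw [LinearEquiv.symm_symm] at hy'
    -- `x₀ := T⁻¹ y T ∈ MT(H(𝒳_{g c₀}))`, hence `E₀ x₀ E₀⁻¹ ∈ MT(H(𝒳'_{c₀}))`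
    have h0 : E₀.trans ((T.symm.trans (y.trans T)).trans E₀.symm) ∈
        ((A' c₀).hodgeStructure ((hf.familyPullback_snd g).isSmoothProjective c₀) (hA' c₀) k).mumfordTateGroup := by
      rw [hE₀, mem_mumfordTateGroup_familyPullback_iff π g k hf A hA A' hA' c₀]
      exact hΓ₀MT hy'
    -- genericity of `c` for `π'`: `T' (…) T'⁻¹ ∈ MT(H(𝒳'_c))`
    have h1 := hc.conj_mem_mumfordTateGroup (familyPullback.snd π g) k hU' (hf.familyPullback_snd g) A' hA' hT' h0
    -- back to `𝒳_{g c}` along `E`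
    have h2 : E.trans ((E.symm.trans ((T'.trans ((E₀.trans ((T.symm.trans (y.trans T)).trans E₀.symm)).trans
        T'.symm)).trans E)).trans E.symm) ∈
        ((A' c).hodgeStructure ((hf.familyPullback_snd g).isSmoothProjective c) (hA' c) k).mumfordTateGroup := by
      have hid : E.trans ((E.symm.trans ((T'.trans ((E₀.trans ((T.symm.trans (y.trans T)).trans E₀.symm)).trans
          T'.symm)).trans E)).trans E.symm) =
          T'.trans ((E₀.trans ((T.symm.trans (y.trans T)).trans E₀.symm)).trans T'.symm) := by
        ext v; simp only [LinearEquiv.trans_apply, LinearEquiv.symm_apply_apply]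
      rw [hid]; exact h1
    rw [hE, mem_mumfordTateGroup_familyPullback_iff π g k hf A hA A' hA' c] at h2
    have hid : E.symm.trans ((T'.trans ((E₀.trans ((T.symm.trans (y.trans T)).trans E₀.symm)).trans T'.symm)).trans E) = y := by
      rw [hTdef]; ext v
      simp only [LinearEquiv.trans_symm, LinearEquiv.trans_apply, LinearEquiv.symm_symm,
        LinearEquiv.symm_apply_apply, LinearEquiv.apply_symm_apply]
    rwa [hid] at h2

/-- **Identity-component currency** of the heredity theorem (the shape consumed by
`signModel_of_identityComponent_le_mumfordTate` and route A's pointwise kernel): under the hypotheses of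
`exists_finiteIndex_le_mumfordTateGroup_map_of_isHodgeGenericPoint_familyPullback`, the identity component
`(Γ_π(g c)^Zar)°` of the Zariski closure of the monodromy group of `π` at `g c` lies in `MT(Hᵏ(𝒳_{g c}))(ℚ)`
(`glIdentityComponent_subset_of_finiteIndex` + `glZariskiClosure_subset_mumfordTateGroup`).
[cite: CarlsonMullerStachPeters2017, Lemma–Definition 15.3.7] -/
theorem glIdentityComponent_ratMonodromyGroup_subset_mumfordTateGroup_of_isHodgeGenericPoint_familyPullback
    {c c₀ : ComplexPoints S'}
    (hc : IsHodgeGenericPoint (familyPullback.snd π g) k hU' (hf.familyPullback_snd g) A' hA' ⟨c, Set.mem_univ _⟩)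
    {δ' : Path.Homotopic.Quotient (⟨c, Set.mem_univ _⟩ : (Set.univ : Set (ComplexPoints S'))) ⟨c₀, Set.mem_univ _⟩}
    {T' : singularCohomology ℚ ℚ (ComplexPoints (fiberOver (familyPullback.snd π g) c)) k ≃ₗ[ℚ]
      singularCohomology ℚ ℚ (ComplexPoints (fiberOver (familyPullback.snd π g) c₀)) k}
    (hT' : IsRatTransport (familyPullback.snd π g) k hU' δ' T')
    (hFI : ∃ Γ₀ : Subgroup (singularCohomology ℚ ℚ (ComplexPoints (fiberOver π (AlgPoints.map g c₀))) k ≃ₗ[ℚ]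
        singularCohomology ℚ ℚ (ComplexPoints (fiberOver π (AlgPoints.map g c₀))) k),
      Γ₀ ≤ ratMonodromyGroup π k hU ⟨AlgPoints.map g c₀, Set.mem_univ _⟩ ∧
      (Γ₀.subgroupOf (ratMonodromyGroup π k hU ⟨AlgPoints.map g c₀, Set.mem_univ _⟩)).FiniteIndex ∧
        Γ₀ ≤ ((A (AlgPoints.map g c₀)).hodgeStructure (hf.isSmoothProjective (AlgPoints.map g c₀))
          (hA (AlgPoints.map g c₀)) k).mumfordTateGroup) :
    glIdentityComponent (ratMonodromyGroup π k hU ⟨AlgPoints.map g c, Set.mem_univ _⟩) ⊆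
      (((A (AlgPoints.map g c)).hodgeStructure (hf.isSmoothProjective (AlgPoints.map g c))
          (hA (AlgPoints.map g c)) k).mumfordTateGroup : Set _) := by
  obtain ⟨Γ₁, hle, hfi, hMT⟩ :=
    exists_finiteIndex_le_mumfordTateGroup_map_of_isHodgeGenericPoint_familyPullback π g k hU hU' hf A hA A' hA' hc hT' hFI
  exact (glIdentityComponent_subset_of_finiteIndex hle hfi).trans (glZariskiClosure_subset_mumfordTateGroup _ hMT)

end BaseChange

end Literature.AlgebraicGeometry.HodgeTheory

end
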